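import Summits.CriticalPhenomena.PercolationContinuityZ3.Theorems.PercNearOneGluingNoHeavyQuantCatHullValueBound
import HarnessLib

/-!
# QUANT lane R8, T-DEC: THE OFFSET VALUE BOUND WITH MONOTONICITY REQUIRED ONLY ON THE SUPPORT — `CatValueBoundS`, the certificate format
# census-2 g78's concrete table instantiates

builds on p205010 (kernel theorem, internal audit signed; external expert review pending)

Support file (`--supports stmt-CriticalPhenomena-4575`), QUANT lane census seat prim-quant-census-2 (gen 78), rung R8 of
`run/shared/lean/prim/quant/LADDER.md`.  One `Prop`-valued structure and theorems; standard axioms, no sorries.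

WHY.  `…QuantCatHullValueBound` (`CatValueBound`, ✓ p520147) asks the table `Z u · A` to be nondecreasing in the reach `G` for EVERY offset `u`.
For an offset `u ∉ S` the true value function is NOT monotone in the reach — a law read there has no atom at `0`, so it cannot be gated — and the
natural tables `Z u G A := Z (σ u) G (A − G·(σ u − u))` (`σ u` = least element of `S` above `u`) are not monotone either.  The induction
(`CatValueBound.bound`) only ever gates at offsets `u ∈ S` (a proper gate puts mass `1 − q > 0` at the atom `0`), so monotonicity on `S` suffices:
* `CatValueBoundS S ψ y B Z` — `tip`, `mono` (for `u ∈ S` only), `shift`, `leaf` as before; `CatValueBound.toS`;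
* **`CatValueBoundS.bound`**, **`CatValueBoundS.hull`**, **`not_inGatedCatHull_of_valueBoundS`** — same statements and proofs as in
  `…QuantCatHullValueBound`, the trivial gate `q = 1` handled apart.
HONEST STATUS.  Certificate FORMAT and its soundness only; no table is supplied here, nothing is refuted here; `TreeBuiltCatHullLight`, `CatPairLight`,
`SiblingStep`, `FarTreeRow` keep their ledger status; RATE class log\* / honest sentence of `run/shared/lean/prim/quant/README.md` unchanged.
[this work].  Nothing here is cited as a published result.  The gluing rows served [cite: KozmaNitzan2024, Conjecture 3 (p. 15)]; product measure
[cite: Grimmett1999, §1.3 p. 10].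
-/

noncomputable section

open scoped BigOperators

namespace Summit.CriticalPhenomena.PercolationContinuityZ3.Theorems
namespace Quant
namespace LawDec

open Finset

/-- **OFFSET VALUE BOUND, monotonicity in the reach on `S` only** — the format census-2 g78's concrete certificate instantiates.  Fields as in
`CatValueBound`: `tip` (the tip `δ₀`), `mono` (a gate lowers the reach; required at offsets `u ∈ S` only), `shift` (a sure blob of `a` relays),
`leaf` (a blob with gate `g < 1` beside a sub-caterpillar whose support fits at both offsets). [this work] -/
structure CatValueBoundS (S : Finset ℕ) (ψ : ℕ → ℝ) (y B : ℝ) (Z : ℕ → ℝ → ℝ → ℝ) : Prop where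
  tip : ∀ u ∈ S, ∀ G : ℝ, y < G → G ≤ 1 → 0 ≤ Z u G 0
  mono : ∀ u ∈ S, ∀ (G G' A : ℝ), y < G → G ≤ G' → G' ≤ 1 → 0 ≤ A → A ≤ G * (B - u) → Z u G A ≤ Z u G' A
  shift : ∀ (u a : ℕ) (G A : ℝ), 1 ≤ a → y < G → G ≤ 1 → 0 ≤ A → A ≤ G * (B - (u + a : ℕ)) →
    Z (u + a) G A + G * (ψ (u + a) - ψ u) ≤ Z u G (A + G * a)
  leaf : ∀ (u a : ℕ) (G g x : ℝ) (N : ℕ) (ν : ℕ → ℝ), 1 ≤ a → y < G → G ≤ 1 → y ≤ G * x → x ≤ g → g < 1 → CatBuilt x N ν →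
    (∀ h, ν h ≠ 0 → u + h ∈ S ∧ u + a + h ∈ S) →
    G * ((1 - g) * offFun ψ N ν u + g * offFun ψ N ν (u + a) - ψ u) ≤ Z u G (G * (lmean N ν + a * g))

/-- the stronger format implies the weaker one. [this work] -/
theorem CatValueBound.toS {S : Finset ℕ} {ψ : ℕ → ℝ} {y B : ℝ} {Z : ℕ → ℝ → ℝ → ℝ} (hZ : CatValueBound S ψ y B Z) :
    CatValueBoundS S ψ y B Z :=
  ⟨hZ.tip, fun u _ => hZ.mono u, hZ.shift, hZ.leaf⟩

namespace CatValueBoundS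

variable {S : Finset ℕ} {ψ : ℕ → ℝ} {y B : ℝ} {Z : ℕ → ℝ → ℝ → ℝ}

/-- **THE BOUND ALONG THE CATERPILLAR RECURSION** for the `S`-monotone format: for every `CatBuilt x N μ`, reach `G` with `y ≤ G·x`, `G ≤ 1`,
and offset `u` with `u + supp μ ⊆ S`: `G · (offFun ψ N μ u − ψ u) ≤ Z u G (G · mean μ)`.  Induction on `CatBuilt`; a proper gate `q < 1` puts
mass at `0`, so its offset lies in `S` and `mono` applies; the trivial gate is the law itself. [this work] -/
theorem bound (hZ : CatValueBoundS S ψ y B Z) (hy : 0 < y) (hB : ∀ s ∈ S, (s : ℝ) ≤ B) {x : ℝ} {N : ℕ} {μ : ℕ → ℝ}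
    (hμ : CatBuilt x N μ) :
    ∀ G : ℝ, y ≤ G * x → G ≤ 1 → ∀ u : ℕ, (∀ h, μ h ≠ 0 → u + h ∈ S) →
      G * (offFun ψ N μ u - ψ u) ≤ Z u G (G * lmean N μ) := by
  induction hμ with
  | nil x₀ hx0 hx1 =>
    intro G hGx hG1 u hsupp
    have hyG : y < G := by nlinarith
    have hu : u ∈ S := by simpa using hsupp 0 (by simp)
    rw [offFun_nil, sub_self, mul_zero]
    have hm : lmean 0 (fun h => if h = 0 then (1 : ℝ) else 0) = 0 := by simp [lmean]
    rw [hm, mul_zero]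
    exact hZ.tip u hu G hyG hG1
  | @slice x₀ M₀ μ₀ h₀ a g hxg hg1 ih =>
    intro G hGx hG1 u hsupp
    obtain ⟨f0, fM, f1, _⟩ := h₀.lawFacts
    have hx0 : 0 < x₀ := h₀.floor.1
    have hyG : y < G := by nlinarith [h₀.floor.2]
    have hG0 : 0 < G := hy.trans hyG
    rw [offFun_slice ψ M₀ μ₀ a g fM u, lmean_slice M₀ μ₀ a g fM f1]
    rcases Nat.eq_zero_or_pos a with ha | ha
    · subst ha
      rw [Nat.add_zero, Nat.cast_zero, zero_mul, add_zero, show (1 - g) * offFun ψ M₀ μ₀ u + g * offFun ψ M₀ μ₀ u = offFun ψ M₀ μ₀ u by ring]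
      refine ih G hGx hG1 u fun h hh => hsupp h ?_
      simp only [slice, Nat.zero_le, if_true, Nat.sub_zero]
      intro hc; apply hh; nlinarith [f0 h]
    rcases eq_or_lt_of_le hg1 with hg | hg
    · subst hg
      have hsupp' : ∀ h, μ₀ h ≠ 0 → u + a + h ∈ S := by
        intro h hh
        have := hsupp (h + a) (by
          simp only [slice, sub_self, zero_mul, zero_add, one_mul, Nat.le_add_left, if_true, Nat.add_sub_cancel]; exact hh)
        rwa [show u + (h + a) = u + a + h by omega] at this
      have key := ih G hGx hG1 (u + a) hsupp'
      have hA0 : 0 ≤ G * lmean M₀ μ₀ := mul_nonneg hG0.le (lmean_nonneg f0)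
      have hAB : G * lmean M₀ μ₀ ≤ G * (B - (u + a : ℕ)) := mul_le_mul_of_nonneg_left (lmean_le_of_supp hB f0 f1 hsupp') hG0.le
      have hs := hZ.shift u a G (G * lmean M₀ μ₀) ha hyG hG1 hA0 hAB
      have e : G * (lmean M₀ μ₀ + (a : ℝ) * 1) = G * lmean M₀ μ₀ + G * a := by ring
      rw [e]
      nlinarith [key, hs]
    · have hg0 : 0 < g := hx0.trans_le hxg
      have hsupp' : ∀ h, μ₀ h ≠ 0 → u + h ∈ S ∧ u + a + h ∈ S := by
        intro h hh
        have hpos : 0 < μ₀ h := lt_of_le_of_ne (f0 h) (Ne.symm hh)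
        refine ⟨hsupp h ?_, ?_⟩
        · have : (1 - g) * μ₀ h ≤ slice μ₀ a g h := by
            simp only [slice]
            have : 0 ≤ g * (if a ≤ h then μ₀ (h - a) else 0) := mul_nonneg hg0.le (by split_ifs; exacts [f0 _, le_rfl])
            linarith
          intro hc; nlinarith
        · have := hsupp (h + a) (by
            simp only [slice, Nat.le_add_left, if_true, Nat.add_sub_cancel]
            intro hc; nlinarith [f0 (h + a)])
          rwa [show u + (h + a) = u + a + h by omega] at this
      have key := hZ.leaf u a G g x₀ M₀ μ₀ ha hyG hG1 hGx hxg hg h₀ hsupp'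
      have e : G * ((1 - g) * offFun ψ M₀ μ₀ u + g * offFun ψ M₀ μ₀ (u + a) - ψ u)
          = G * ((1 - g) * offFun ψ M₀ μ₀ u + g * offFun ψ M₀ μ₀ (u + a)) - G * ψ u := by ring
      linarith [key]
  | @gate x₀ M₀ μ₀ h₀ q hq0 hq1 ih =>
    intro G hGx hG1 u hsupp
    obtain ⟨f0, fM, f1, _⟩ := h₀.lawFacts
    have hx0 : 0 < x₀ := h₀.floor.1
    rcases eq_or_lt_of_le hq1 with hq | hq
    · -- the trivial gate
      subst hq
      rw [gate_one]; rw [one_mul] at hGx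
      exact ih G hGx hG1 u (fun h hh => hsupp h (by rw [gate_one]; exact hh))
    -- a proper gate: the offset lies in S
    have hu : u ∈ S := by
      have := hsupp 0 (by
        simp only [gate, if_true]
        intro hc; nlinarith [f0 0])
      simpa using this
    have hqx : q * x₀ < 1 := lt_of_le_of_lt (mul_le_of_le_one_left hx0.le hq1) h₀.floor.2
    have hqx0 : 0 < q * x₀ := mul_pos hq0 hx0
    have hG0 : 0 < G := by
      rcases le_or_gt G 0 with hle | hgt
      · nlinarith [mul_nonpos_of_nonpos_of_nonneg hle hqx0.le]
      · exact hgt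
    have hGq : y ≤ G * q * x₀ := by rw [mul_assoc]; exact hGx
    have hGq1 : G * q ≤ 1 := (mul_le_of_le_one_right hG0.le hq1).trans hG1
    rw [offFun_gate, lmean_gate]
    have hsupp' : ∀ h, μ₀ h ≠ 0 → u + h ∈ S := by
      intro h hh
      refine hsupp h ?_
      have hpos : 0 < μ₀ h := lt_of_le_of_ne (f0 h) (Ne.symm hh)
      simp only [gate]
      have : 0 ≤ (if h = 0 then 1 - q else 0 : ℝ) := by split_ifs <;> linarith
      intro hc; nlinarith
    have key := ih (G * q) hGq hGq1 u hsupp'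
    have hA0 : 0 ≤ G * q * lmean M₀ μ₀ := mul_nonneg (mul_nonneg hG0.le hq0.le) (lmean_nonneg f0)
    have hAB : G * q * lmean M₀ μ₀ ≤ G * q * (B - u) := mul_le_mul_of_nonneg_left (lmean_le_of_supp hB f0 f1 hsupp') (mul_nonneg hG0.le hq0.le)
    have hyGq : y < G * q := lt_of_le_of_lt hGq (by nlinarith [mul_lt_mul_of_pos_left h₀.floor.2 (mul_pos hG0 hq0)])
    have hm := hZ.mono u hu (G * q) G (G * q * lmean M₀ μ₀) hyGq (mul_le_of_le_one_right hG0.le hq1) hG1 hA0 hAB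
    have e1 : G * (q * offFun ψ M₀ μ₀ u + (1 - q) * ψ u - ψ u) = G * q * (offFun ψ M₀ μ₀ u - ψ u) := by ring
    have e2 : G * (q * lmean M₀ μ₀) = G * q * lmean M₀ μ₀ := by ring
    rw [e1, e2]
    exact key.trans hm
  | @mono x₀ x' M₀ μ₀ h₀ hx'0 hxx ih =>
    intro G hGx hG1 u hsupp
    have hG0 : 0 ≤ G := by
      rcases le_or_gt 0 G with hle | hgt
      · exact hle
      · have : G * x' ≤ 0 := mul_nonpos_of_nonpos_of_nonneg hgt.le hx'0.le
        linarith
    exact ih G (hGx.trans (mul_le_mul_of_nonneg_left hxx hG0)) hG1 u hsupp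

/-- **THE HULL BOUND** for the `S`-monotone format: a member `μ₀` of `InGatedCatHull y T M` with support in `S` has `Σ ψ h · μ₀ h ≤ ψ 0 + Z 0 1 T`.
[this work] -/
theorem hull (hZ : CatValueBoundS S ψ y B Z) (hy : 0 < y) (hB : ∀ s ∈ S, (s : ℝ) ≤ B) {T : ℝ} {M : ℕ} {μ₀ : ℕ → ℝ}
    (hμ₀ : InGatedCatHull y T M μ₀) (hS : ∀ h, μ₀ h ≠ 0 → h ∈ S) :
    ∑ h ∈ Finset.range (M + 1), ψ h * μ₀ h ≤ ψ 0 + Z 0 1 T := by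
  obtain ⟨ι, hι, w, s, N, P, hw0, hw1, hs, hC, hNM, hmean, hmix⟩ := hμ₀
  have hs0 : ∀ i, 0 < s i := fun i => hy.trans (hs i).1
  have Pf : ∀ i, (∀ k, 0 ≤ P i k) ∧ (∀ k, N i < k → P i k = 0) ∧ ∑ k ∈ Finset.range (N i + 1), P i k = 1 :=
    fun i => ⟨(hC i).lawFacts.1, (hC i).lawFacts.2.1, (hC i).lawFacts.2.2.1⟩
  have Gf : ∀ i, (∀ k, 0 ≤ gate (P i) (s i) k) ∧ (∀ k, N i < k → gate (P i) (s i) k = 0) ∧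
      ∑ k ∈ Finset.range (N i + 1), gate (P i) (s i) k = 1 :=
    fun i => gate_laws (N i) (P i) (s i) (hs0 i).le (hs i).2 (Pf i).1 (Pf i).2.1 (Pf i).2.2
  have hcat : ∀ i, CatBuilt y (N i) (gate (P i) (s i)) := by
    intro i
    have := CatBuilt.gate (hC i) (s i) (hs0 i) (hs i).2
    rwa [mul_div_cancel₀ _ (hs0 i).ne'] at this
  have hmeanT : ∀ i, lmean (N i) (gate (P i) (s i)) = T := by
    intro i; rw [lmean_gate]; exact hmean i
  have hsuppC : ∀ i, 0 < w i → ∀ h, gate (P i) (s i) h ≠ 0 → 0 + h ∈ S := by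
    intro i hwi h hh
    rw [zero_add]
    refine hS h ?_
    have hpos : 0 < gate (P i) (s i) h := lt_of_le_of_ne ((Gf i).1 h) (Ne.symm hh)
    rw [hmix h]
    have : w i * gate (P i) (s i) h ≤ ∑ j, w j * gate (P j) (s j) h :=
      Finset.single_le_sum (f := fun j => w j * gate (P j) (s j) h) (fun j _ => mul_nonneg (hw0 j) ((Gf j).1 h)) (Finset.mem_univ i)
    intro hc; nlinarith [mul_pos hwi hpos]
  have hcol : ∀ i, w i * offFun ψ M (gate (P i) (s i)) 0 ≤ w i * (ψ 0 + Z 0 1 T) := by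
    intro i
    rcases eq_or_lt_of_le (hw0 i) with hz | hpos
    · rw [← hz, zero_mul, zero_mul]
    · refine mul_le_mul_of_nonneg_left ?_ (hw0 i)
      obtain ⟨d, hd⟩ := Nat.exists_eq_add_of_le (hNM i)
      rw [hd, offFun_extend ψ (N i) d _ (Gf i).2.1]
      have key := hZ.bound hy hB (hcat i) 1 (by rw [one_mul]) le_rfl 0 (hsuppC i hpos)
      rw [one_mul, one_mul, hmeanT i] at key
      linarith
  have e : ∑ h ∈ Finset.range (M + 1), ψ h * μ₀ h = ∑ i, w i * offFun ψ M (gate (P i) (s i)) 0 := by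
    unfold offFun
    simp_rw [zero_add, Finset.mul_sum]
    rw [Finset.sum_comm]
    refine Finset.sum_congr rfl fun h _ => ?_
    rw [hmix h, Finset.mul_sum]
    exact Finset.sum_congr rfl fun i _ => by ring
  rw [e]
  calc ∑ i, w i * offFun ψ M (gate (P i) (s i)) 0 ≤ ∑ i, w i * (ψ 0 + Z 0 1 T) := Finset.sum_le_sum fun i _ => hcol i
    _ = ψ 0 + Z 0 1 T := by rw [← Finset.sum_mul, hw1, one_mul]

end CatValueBoundS

/-- **EXCLUSION FROM THE HULL BY AN `S`-MONOTONE CERTIFICATE**: support in `S` and `ψ 0 + Z 0 1 T < Σ ψ h · μ₀ h` exclude `μ₀` from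
`InGatedCatHull y T M`. [this work] -/
theorem not_inGatedCatHull_of_valueBoundS {S : Finset ℕ} {ψ : ℕ → ℝ} {y B : ℝ} {Z : ℕ → ℝ → ℝ → ℝ} (hZ : CatValueBoundS S ψ y B Z)
    (hy : 0 < y) (hB : ∀ s ∈ S, (s : ℝ) ≤ B) {T : ℝ} {M : ℕ} {μ₀ : ℕ → ℝ} (hS : ∀ h, μ₀ h ≠ 0 → h ∈ S)
    (hsep : ψ 0 + Z 0 1 T < ∑ h ∈ Finset.range (M + 1), ψ h * μ₀ h) : ¬ InGatedCatHull y T M μ₀ :=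
  fun hmem => absurd (hZ.hull hy hB hmem hS) (not_le.2 hsep)

end LawDec
end Quant
end Summit.CriticalPhenomena.PercolationContinuityZ3.Theorems
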